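import Summits.HubbardSuperconductivity.HubbardSuperconductivity.Theorems.TwTipContinuation.Negative.TipNormalForm
import Summits.HubbardSuperconductivity.HubbardSuperconductivity.Theorems.TwTipContinuation.Negative.CornerDanskin
import Summits.HubbardSuperconductivity.HubbardSuperconductivity.Theorems.ThermalWedgeTwTipContinuationDanskinAttainment
import Summits.HubbardSuperconductivity.HubbardSuperconductivity.Theorems.ThermalWedgeTwTipContinuationEdgeOrder
import Summits.HubbardSuperconductivity.HubbardSuperconductivity.Theorems.ThermalWedgeTwTipContinuationTransportNormalForm
import Summits.HubbardSuperconductivity.HubbardSuperconductivity.Theorems.ThermalWedgeTwTipContinuationGroundSpaceHomogeneity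

/-!
# `TwTipContinuation` (stmt-HubbardSuperconductivity-1700), line `isogap-submodular-transport`:
# the line CLOSED MODULO ITS TWO RESIDUALS, and the every-ground-state residual as a universal adapter

The lead skeleton (`Cruxes/TwTipContinuation/Lines/isogap_submodular_transport.lean`, v4) proves the crux from four
stubs, two of which are theorems (`stub_edgeOrder`, p79900; `stub_danskinAttainment`, p74240). The two open stubs
have landed NORMAL FORMS: `stub_isogapTransport` ⇐ ORDER DOMINANCE (`stub_isogapTransport_of_orderDominance`,
p80291: at one doping of `[1/10,3/10]` and for all small `U`, eventually in even `L`, some normalised sector ground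
state of the pure torus dominates, up to `εL⁴`, the d-wave pair intensity of some normalised ground state of the free
seeded torus at seed `aU² + s₁`) and `stub_groundSpaceHomogeneity` ⇐ SCALAR-ON-GROUND
(`stub_groundSpaceHomogeneity_of_scalarOnGround`, p74912: eventually in even `L`, `P_L = Δ_dᴴΔ_d` has scalar matrix
elements on the sector ground eigenspace of the pure torus). This file records, as sorry-free implications on the
literal route terms, what the crux then costs:

* `everyGSOrder_of_existsGSOrder_of_homogeneity` — one side: a normalised ground state with `c L⁴ ≤ re⟨P_L⟩` plus
  homogeneity up to `εL⁴` gives `(c − ε) L⁴ ≤ re⟨P_L⟩` for EVERY normalised ground state;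
* `twTipContinuation_of_existsGSOrderWindow_of_scalarOnGround` — the every-GS residual is a UNIVERSAL ADAPTER: ANY
  `∃`-ground-state d-wave order window of the pure torus (one `δ ∈ [1/10,2/5]`, all `U ≤ U₁`, constants may depend
  on `U`) together with scalar-on-ground on the window proves the crux;
* `existsGSOrderWindow_of_orderDominance` — the isogap engine: order dominance (+ the landed edge order, chords and
  Danskin attainment) gives exactly such an `∃`-GS order window (constant `3μ(δ,aU²)/4`);
* `twTipContinuation_of_orderDominance_of_scalarOnGround` — hence the line's two residuals prove the crux;
* `twTipContinuation_of_uniformRungsWindow_of_scalarOnGround` — and so does the ANCHOR side strengthened to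
  g-uniform rungs near the corner at fixed `U` (`CornerDanskin.existsGSOrder_pure_of_uniformRungs`) plus the same
  every-GS residual.

No hypothesis here is proved; none is a published result (both residuals are open: weak-coupling Kohn–Luttinger
d-wave order of the pure 2D Hubbard torus as a theorem; absence of accidental ground degeneracy for `U > 0` away from
half filling). Bookkeeping over landed files only; no definition is introduced.
-/

noncomputable section

namespace Summit.HubbardSuperconductivity.TwTipContinuation.IsogapTransport

open Matrix Filter Finset
open Literature.MathematicalPhysics.QuantumLattice Literature.Probability.LatticeModels
open Summit.HubbardSuperconductivity.HubbardSuperconductivity.Theses.ThermalWedge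
open Summit.HubbardSuperconductivity.TwTipContinuation.Negative
open scoped ComplexOrder

/-- **From one ordered ground state to all, given homogeneity (one side).** If some normalised sector ground
state `ψ₀` of `H` has `c L⁴ ≤ re⟨ψ₀, P_L ψ₀⟩` and any two normalised sector ground states have pair intensities
within `ε L⁴`, then every normalised sector ground state has `(c − ε) L⁴ ≤ re⟨P_L⟩`. [folklore] -/
theorem everyGSOrder_of_existsGSOrder_of_homogeneity :
    ∀ (L : ℕ) [NeZero L] (U c ε : ℝ) (n : ℕ),
    (∃ ψ₀ : Fock (Orb (FermionTorus 2 L)), star ψ₀ ⬝ᵥ ψ₀ = 1 ∧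
      IsGroundStateInSector (hubbardTorus 2 L 1 U) (2 * n) 0 ψ₀ ∧
        c * (L : ℝ) ^ 4 ≤ (expect ((pairField dWaveFormFactor L)ᴴ * pairField dWaveFormFactor L) ψ₀).re) →
    (∀ ψ ψ' : Fock (Orb (FermionTorus 2 L)), star ψ ⬝ᵥ ψ = 1 → star ψ' ⬝ᵥ ψ' = 1 →
      IsGroundStateInSector (hubbardTorus 2 L 1 U) (2 * n) 0 ψ →
      IsGroundStateInSector (hubbardTorus 2 L 1 U) (2 * n) 0 ψ' →
        (expect ((pairField dWaveFormFactor L)ᴴ * pairField dWaveFormFactor L) ψ).re ≤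
          (expect ((pairField dWaveFormFactor L)ᴴ * pairField dWaveFormFactor L) ψ').re + ε * (L : ℝ) ^ 4) →
    ∀ ψ : Fock (Orb (FermionTorus 2 L)), star ψ ⬝ᵥ ψ = 1 →
      IsGroundStateInSector (hubbardTorus 2 L 1 U) (2 * n) 0 ψ →
        (c - ε) * (L : ℝ) ^ 4 ≤ (expect ((pairField dWaveFormFactor L)ᴴ * pairField dWaveFormFactor L) ψ).re := by
  intro L _ U c ε n hex hhom ψ hψ hgs
  obtain ⟨ψ₀, hψ₀, hgs₀, hc⟩ := hex
  have h := hhom ψ₀ ψ hψ₀ hψ hgs₀ hgs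
  have : (c - ε) * (L : ℝ) ^ 4 = c * (L : ℝ) ^ 4 - ε * (L : ℝ) ^ 4 := by ring
  linarith

/-- **The every-ground-state residual is a universal adapter.** An `∃`-ground-state d-wave order window of the
pure torus — one doping `δ ∈ [1/10,2/5]` and `U₁ > 0` such that for every `U ∈ (0,U₁]`, with a constant that may
depend on `U`, eventually in even `L` SOME normalised sector ground state of `hubbardTorus 2 L 1 U` has
`c L⁴ ≤ re⟨P_L⟩` — together with eventual scalar matrix elements of `P_L` on the sector ground eigenspace (for every
doping of the window, all small `U`) proves `TwTipContinuation`: homogeneity at `ε = c/2`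
(`stub_groundSpaceHomogeneity_of_scalarOnGround`), every GS `≥ (c/2)L⁴`, `summitMatrix_of_everyGSOrder`,
`twTipContinuation_of_uniformSummit`. Neither hypothesis is proved. [folklore] -/
theorem twTipContinuation_of_existsGSOrderWindow_of_scalarOnGround :
    (∃ U₁ : ℝ, 0 < U₁ ∧ ∃ δ ∈ Set.Icc (1 / 10 : ℝ) (2 / 5), ∀ U ∈ Set.Ioc (0 : ℝ) U₁,
      ∃ c : ℝ, 0 < c ∧ ∃ L₀ : ℕ, ∀ (L : ℕ) [NeZero L], L₀ ≤ L → Even L →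
        ∃ ψ : Fock (Orb (FermionTorus 2 L)), star ψ ⬝ᵥ ψ = 1 ∧
          IsGroundStateInSector (hubbardTorus 2 L 1 U) (2 * ⌊(1 - δ) * (L : ℝ) ^ 2 / 2⌋₊) 0 ψ ∧
            c * (L : ℝ) ^ 4 ≤ (expect ((pairField dWaveFormFactor L)ᴴ * pairField dWaveFormFactor L) ψ).re) →
    (∀ δ ∈ Set.Icc (1 / 10 : ℝ) (2 / 5), ∃ U₁ : ℝ, 0 < U₁ ∧ ∀ U ∈ Set.Ioc (0 : ℝ) U₁,
      ∃ L₀ : ℕ, ∀ (L : ℕ) [NeZero L], L₀ ≤ L → Even L →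
      ∃ μ : ℂ, ∀ v ∈ szSector (Λ := FermionTorus 2 L) (2 * ⌊(1 - δ) * (L : ℝ) ^ 2 / 2⌋₊) 0 ⊓ Module.End.eigenspace (Matrix.toLin' (hubbardTorus 2 L 1 U)) (((hubbardTorus 2 L 1 U).minEnergyOn (szSector (Λ := FermionTorus 2 L) (2 * ⌊(1 - δ) * (L : ℝ) ^ 2 / 2⌋₊) 0) : ℝ) : ℂ),
        ∀ w ∈ szSector (Λ := FermionTorus 2 L) (2 * ⌊(1 - δ) * (L : ℝ) ^ 2 / 2⌋₊) 0 ⊓ Module.End.eigenspace (Matrix.toLin' (hubbardTorus 2 L 1 U)) (((hubbardTorus 2 L 1 U).minEnergyOn (szSector (Λ := FermionTorus 2 L) (2 * ⌊(1 - δ) * (L : ℝ) ^ 2 / 2⌋₊) 0) : ℝ) : ℂ),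
        star w ⬝ᵥ ((pairField dWaveFormFactor L)ᴴ * pairField dWaveFormFactor L) *ᵥ v = μ * (star w ⬝ᵥ v)) →
    TwTipContinuation := by
  intro hord hscal
  obtain ⟨U₁, hU₁, δ, hδ, hord⟩ := hord
  obtain ⟨U₂, hU₂, hhom⟩ := stub_groundSpaceHomogeneity_of_scalarOnGround hscal δ hδ
  refine twTipContinuation_of_uniformSummit ⟨min U₁ U₂, lt_min hU₁ hU₂, δ, hδ, fun U hU => ?_⟩
  apply summitMatrix_of_everyGSOrder
  have hU1 : U ∈ Set.Ioc (0 : ℝ) U₁ := ⟨hU.1, hU.2.trans (min_le_left _ _)⟩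
  have hU2 : U ∈ Set.Ioc (0 : ℝ) U₂ := ⟨hU.1, hU.2.trans (min_le_right _ _)⟩
  obtain ⟨c, hc, L₁, hex⟩ := hord U hU1
  obtain ⟨L₂, hhom'⟩ := hhom U hU2 (c / 2) (by positivity)
  refine ⟨c / 2, by positivity, max L₁ L₂, fun L _ hL hEv ψ hψ hgs => ?_⟩
  have hL₁ : L₁ ≤ L := le_trans (le_max_left _ _) hL
  have hL₂ : L₂ ≤ L := le_trans (le_max_right _ _) hL
  have key := everyGSOrder_of_existsGSOrder_of_homogeneity L U c (c / 2) _ (hex L hL₁ hEv) (hhom' L hL₂ hEv) ψ hψ hgs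
  have : (c - c / 2) * (L : ℝ) ^ 4 = c / 2 * (L : ℝ) ^ 4 := by ring
  linarith

/-- **The isogap engine up to its residual: order dominance ⇒ an `∃`-GS order window.** If at one doping of
`[1/10,3/10]` and for all `U ∈ (0,U₁]`, eventually in even `L`, some normalised sector ground state of the pure
torus dominates (up to `εL⁴`, every `ε > 0`) the pair intensity of some normalised ground state of the free seeded
torus `hubbardTorus 2 L 1 0 − ((aU²+s₁)/L²)P_L`, then the pure torus has an `∃`-ground-state d-wave order window with
constant `3μ/4`, `μ = μ(δ, aU²)` the landed edge order (`stub_edgeOrder`): dominance ⇒ transport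
(`stub_isogapTransport_of_orderDominance`) ⇒ with the right chord on the ordered free edge a linear gain
`(3μ/4) s L²` of the pure torus from every seed `s ∈ (0,s₁)` ⇒ Danskin attainment (`stub_danskinAttainment`).
The dominance hypothesis is NOT proved (it is Kohn–Luttinger weak-coupling d-wave order as a theorem). [folklore] -/
theorem existsGSOrderWindow_of_orderDominance :
    (∃ δ ∈ Set.Icc (1 / 10 : ℝ) (3 / 10), ∃ U₁ a : ℝ, 0 < U₁ ∧ 0 < a ∧ ∀ U ∈ Set.Ioc (0 : ℝ) U₁, ∃ s₁ : ℝ, 0 < s₁ ∧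
      ∀ ε : ℝ, 0 < ε → ∃ L₀ : ℕ, ∀ (L : ℕ) [NeZero L], L₀ ≤ L → Even L →
        ∃ ψ φ : Fock (Orb (FermionTorus 2 L)), star ψ ⬝ᵥ ψ = 1 ∧ star φ ⬝ᵥ φ = 1 ∧
          IsGroundStateInSector (hubbardTorus 2 L 1 U) (2 * ⌊(1 - δ) * (L : ℝ) ^ 2 / 2⌋₊) 0 ψ ∧
          IsGroundStateInSector (hubbardTorus 2 L 1 0 - (((a * U ^ 2 + s₁) / (L : ℝ) ^ 2 : ℝ) : ℂ) • ((pairField dWaveFormFactor L)ᴴ * pairField dWaveFormFactor L)) (2 * ⌊(1 - δ) * (L : ℝ) ^ 2 / 2⌋₊) 0 φ ∧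
          (expect ((pairField dWaveFormFactor L)ᴴ * pairField dWaveFormFactor L) φ).re ≤
            (expect ((pairField dWaveFormFactor L)ᴴ * pairField dWaveFormFactor L) ψ).re + ε * (L : ℝ) ^ 4) →
    ∃ U₁ : ℝ, 0 < U₁ ∧ ∃ δ ∈ Set.Icc (1 / 10 : ℝ) (2 / 5), ∀ U ∈ Set.Ioc (0 : ℝ) U₁,
      ∃ c : ℝ, 0 < c ∧ ∃ L₀ : ℕ, ∀ (L : ℕ) [NeZero L], L₀ ≤ L → Even L →
        ∃ ψ : Fock (Orb (FermionTorus 2 L)), star ψ ⬝ᵥ ψ = 1 ∧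
          IsGroundStateInSector (hubbardTorus 2 L 1 U) (2 * ⌊(1 - δ) * (L : ℝ) ^ 2 / 2⌋₊) 0 ψ ∧
            c * (L : ℝ) ^ 4 ≤ (expect ((pairField dWaveFormFactor L)ᴴ * pairField dWaveFormFactor L) ψ).re := by
  intro hdom
  obtain ⟨δ, hδ3, U₁, a, hU₁, ha, hT⟩ := stub_isogapTransport_of_orderDominance hdom
  have hδ : δ ∈ Set.Icc (1 / 10 : ℝ) (2 / 5) := ⟨hδ3.1, hδ3.2.trans (by norm_num)⟩
  refine ⟨U₁, hU₁, δ, hδ, fun U hU => ?_⟩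
  have hδ' : (-1 : ℝ) ≤ δ := by linarith [hδ.1]
  have haU : 0 < a * U ^ 2 := by
    have := hU.1
    positivity
  obtain ⟨μ, hμ, L₁, hE⟩ := stub_edgeOrder δ hδ (a * U ^ 2) haU
  obtain ⟨s₁, hs₁, hT'⟩ := hT U hU
  obtain ⟨L₂, hT''⟩ := hT' (μ / 4) (by positivity)
  refine ⟨3 * μ / 4, by positivity, max L₁ L₂, fun L _ hL hEv => ?_⟩
  have hL₁ : L₁ ≤ L := le_trans (le_max_left _ _) hL
  have hL₂ : L₂ ≤ L := le_trans (le_max_right _ _) hL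
  have hn : ⌊(1 - δ) * (L : ℝ) ^ 2 / 2⌋₊ ≤ Fintype.card (FermionTorus 2 L) := by
    rw [Summit.HubbardSuperconductivity.NoGo.card_fermionTorus_two]
    exact Summit.HubbardSuperconductivity.NoGo.floor_pairNumber_le δ hδ' L
  have hLpos : (0 : ℝ) < (L : ℝ) ^ 2 := by
    have := NeZero.pos L
    positivity
  -- the pure torus gains at least `(3μ/4) s L²` from every seed `s ∈ (0, s₁)`
  have hgain : ∀ s ∈ Set.Ioo (0 : ℝ) s₁, (3 * μ / 4 * (L : ℝ) ^ 2) * s ≤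
      (Matrix.minEnergyOn (hubbardTorus 2 L 1 U) (szSector (2 * ⌊(1 - δ) * (L : ℝ) ^ 2 / 2⌋₊) 0))
        - (Matrix.minEnergyOn (hubbardTorus 2 L 1 U - ((s / (L : ℝ) ^ 2 : ℝ) : ℂ) • ((pairField dWaveFormFactor L)ᴴ * pairField dWaveFormFactor L)) (szSector (2 * ⌊(1 - δ) * (L : ℝ) ^ 2 / 2⌋₊) 0)) := by
    intro s hs
    -- free edge: right chord at a normalised ground state of the seed `aU²`, ordered by `stub_edgeOrder`
    obtain ⟨φ, hφ, hφgs⟩ := exists_unit_groundState 0 (a * U ^ 2) L hn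
    have hr := order_le_rightChord (U := 0) (g := a * U ^ 2) (g'' := a * U ^ 2 + s) (by linarith [hs.1]) hφ hφgs
    have hb := hE L hL₁ hEv φ hφ hφgs
    have key : (a * U ^ 2 + s - a * U ^ 2) / (L : ℝ) ^ 2 * (μ * (L : ℝ) ^ 4) ≤
        (a * U ^ 2 + s - a * U ^ 2) / (L : ℝ) ^ 2 * (expect ((pairField dWaveFormFactor L)ᴴ * pairField dWaveFormFactor L) φ).re :=
      mul_le_mul_of_nonneg_left hb (div_nonneg (by linarith [hs.1]) hLpos.le)
    have hid : (a * U ^ 2 + s - a * U ^ 2) / (L : ℝ) ^ 2 * (μ * (L : ℝ) ^ 4) = μ * s * (L : ℝ) ^ 2 := by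
      field_simp
      ring
    have hB := hT'' L hL₂ hEv s ⟨hs.1, hs.2.le⟩
    have : (3 * μ / 4 * (L : ℝ) ^ 2) * s = μ * s * (L : ℝ) ^ 2 - μ / 4 * s * (L : ℝ) ^ 2 := by ring
    linarith
  obtain ⟨ψ₀, hψ₀, hgs₀, hP₀⟩ := stub_danskinAttainment L U _ (3 * μ / 4 * (L : ℝ) ^ 2) s₁ hn hs₁ hgain
  refine ⟨ψ₀, hψ₀, hgs₀, ?_⟩
  have : 3 * μ / 4 * (L : ℝ) ^ 2 * (L : ℝ) ^ 2 = 3 * μ / 4 * (L : ℝ) ^ 4 := by ring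
  linarith

/-- **The isogap line closed modulo its two residuals.** Order dominance (the normal form of the open
`stub_isogapTransport`, p80291) and eventual scalar ground compressions of `P_L` (the registered sub-goal behind the
open `stub_groundSpaceHomogeneity`, p74912) together prove `TwTipContinuation`. Neither is proved; this is the exact
debt of the line. [folklore] -/
theorem twTipContinuation_of_orderDominance_of_scalarOnGround :
    (∃ δ ∈ Set.Icc (1 / 10 : ℝ) (3 / 10), ∃ U₁ a : ℝ, 0 < U₁ ∧ 0 < a ∧ ∀ U ∈ Set.Ioc (0 : ℝ) U₁, ∃ s₁ : ℝ, 0 < s₁ ∧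
      ∀ ε : ℝ, 0 < ε → ∃ L₀ : ℕ, ∀ (L : ℕ) [NeZero L], L₀ ≤ L → Even L →
        ∃ ψ φ : Fock (Orb (FermionTorus 2 L)), star ψ ⬝ᵥ ψ = 1 ∧ star φ ⬝ᵥ φ = 1 ∧
          IsGroundStateInSector (hubbardTorus 2 L 1 U) (2 * ⌊(1 - δ) * (L : ℝ) ^ 2 / 2⌋₊) 0 ψ ∧
          IsGroundStateInSector (hubbardTorus 2 L 1 0 - (((a * U ^ 2 + s₁) / (L : ℝ) ^ 2 : ℝ) : ℂ) • ((pairField dWaveFormFactor L)ᴴ * pairField dWaveFormFactor L)) (2 * ⌊(1 - δ) * (L : ℝ) ^ 2 / 2⌋₊) 0 φ ∧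
          (expect ((pairField dWaveFormFactor L)ᴴ * pairField dWaveFormFactor L) φ).re ≤
            (expect ((pairField dWaveFormFactor L)ᴴ * pairField dWaveFormFactor L) ψ).re + ε * (L : ℝ) ^ 4) →
    (∀ δ ∈ Set.Icc (1 / 10 : ℝ) (2 / 5), ∃ U₁ : ℝ, 0 < U₁ ∧ ∀ U ∈ Set.Ioc (0 : ℝ) U₁,
      ∃ L₀ : ℕ, ∀ (L : ℕ) [NeZero L], L₀ ≤ L → Even L →
      ∃ μ : ℂ, ∀ v ∈ szSector (Λ := FermionTorus 2 L) (2 * ⌊(1 - δ) * (L : ℝ) ^ 2 / 2⌋₊) 0 ⊓ Module.End.eigenspace (Matrix.toLin' (hubbardTorus 2 L 1 U)) (((hubbardTorus 2 L 1 U).minEnergyOn (szSector (Λ := FermionTorus 2 L) (2 * ⌊(1 - δ) * (L : ℝ) ^ 2 / 2⌋₊) 0) : ℝ) : ℂ),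
        ∀ w ∈ szSector (Λ := FermionTorus 2 L) (2 * ⌊(1 - δ) * (L : ℝ) ^ 2 / 2⌋₊) 0 ⊓ Module.End.eigenspace (Matrix.toLin' (hubbardTorus 2 L 1 U)) (((hubbardTorus 2 L 1 U).minEnergyOn (szSector (Λ := FermionTorus 2 L) (2 * ⌊(1 - δ) * (L : ℝ) ^ 2 / 2⌋₊) 0) : ℝ) : ℂ),
        star w ⬝ᵥ ((pairField dWaveFormFactor L)ᴴ * pairField dWaveFormFactor L) *ᵥ v = μ * (star w ⬝ᵥ v)) →
    TwTipContinuation := fun hdom hscal =>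
  twTipContinuation_of_existsGSOrderWindow_of_scalarOnGround (existsGSOrderWindow_of_orderDominance hdom) hscal

/-- **The anchor side with g-uniform constants, modulo the same residual.** If at one doping of the window and
for all `U ∈ (0,U₁]` the seeded family `hubbardTorus 2 L 1 U − (g/L²)P_L` has every-ground-state order `c(U) L⁴`
UNIFORMLY in the seeds `g ∈ (0, g₁(U)]` eventually in even `L` (the `CornerPersistence` shape of the anchor; not
the `U`-uniform shape refuted by `WeakCouplingDarkness.not_uniformRungsWindow`), then by the landed corner Danskin
(`CornerDanskin.existsGSOrder_pure_of_uniformRungs`) the pure torus has an `∃`-GS order window, and scalar-on-ground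
finishes the crux. Neither hypothesis is proved. [folklore] -/
theorem twTipContinuation_of_uniformRungsWindow_of_scalarOnGround :
    (∃ U₁ : ℝ, 0 < U₁ ∧ ∃ δ ∈ Set.Icc (1 / 10 : ℝ) (2 / 5), ∀ U ∈ Set.Ioc (0 : ℝ) U₁,
      ∃ c : ℝ, 0 < c ∧ ∃ g₁ : ℝ, 0 < g₁ ∧ ∃ L₀ : ℕ, ∀ (L : ℕ) [NeZero L], L₀ ≤ L → Even L →
        ∀ g ∈ Set.Ioc (0 : ℝ) g₁, ∀ ψ : Fock (Orb (FermionTorus 2 L)), star ψ ⬝ᵥ ψ = 1 →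
          IsGroundStateInSector (hubbardTorus 2 L 1 U - ((g / (L : ℝ) ^ 2 : ℝ) : ℂ) • ((pairField dWaveFormFactor L)ᴴ * pairField dWaveFormFactor L)) (2 * ⌊(1 - δ) * (L : ℝ) ^ 2 / 2⌋₊) 0 ψ →
            c * (L : ℝ) ^ 4 ≤ (expect ((pairField dWaveFormFactor L)ᴴ * pairField dWaveFormFactor L) ψ).re) →
    (∀ δ ∈ Set.Icc (1 / 10 : ℝ) (2 / 5), ∃ U₁ : ℝ, 0 < U₁ ∧ ∀ U ∈ Set.Ioc (0 : ℝ) U₁,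
      ∃ L₀ : ℕ, ∀ (L : ℕ) [NeZero L], L₀ ≤ L → Even L →
      ∃ μ : ℂ, ∀ v ∈ szSector (Λ := FermionTorus 2 L) (2 * ⌊(1 - δ) * (L : ℝ) ^ 2 / 2⌋₊) 0 ⊓ Module.End.eigenspace (Matrix.toLin' (hubbardTorus 2 L 1 U)) (((hubbardTorus 2 L 1 U).minEnergyOn (szSector (Λ := FermionTorus 2 L) (2 * ⌊(1 - δ) * (L : ℝ) ^ 2 / 2⌋₊) 0) : ℝ) : ℂ),
        ∀ w ∈ szSector (Λ := FermionTorus 2 L) (2 * ⌊(1 - δ) * (L : ℝ) ^ 2 / 2⌋₊) 0 ⊓ Module.End.eigenspace (Matrix.toLin' (hubbardTorus 2 L 1 U)) (((hubbardTorus 2 L 1 U).minEnergyOn (szSector (Λ := FermionTorus 2 L) (2 * ⌊(1 - δ) * (L : ℝ) ^ 2 / 2⌋₊) 0) : ℝ) : ℂ),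
        star w ⬝ᵥ ((pairField dWaveFormFactor L)ᴴ * pairField dWaveFormFactor L) *ᵥ v = μ * (star w ⬝ᵥ v)) →
    TwTipContinuation := by
  intro hrung hscal
  obtain ⟨U₁, hU₁, δ, hδ, hrung⟩ := hrung
  refine twTipContinuation_of_existsGSOrderWindow_of_scalarOnGround ⟨U₁, hU₁, δ, hδ, fun U hU => ?_⟩ hscal
  have hδ' : (-1 : ℝ) ≤ δ := by linarith [hδ.1]
  exact existsGSOrder_pure_of_uniformRungs hδ' (hrung U hU)

end Summit.HubbardSuperconductivity.TwTipContinuation.IsogapTransport
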